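import Summits.QuantumFields.QCD.Theses.HeatSlicedQuarks
import Literature.MathematicalPhysics.QuantumLattice.GrassmannGaussianMoments
import Summits.QuantumFields.QCD.Theorems.HeatSlicedQuarksInterleavedHeatSliceFlowStubDefectMinorBound

/-!
# Stub `stub_defectMomentBound` of line `Sketch`
(crux `Summit.QuantumFields.QCD.Theses.HeatSlicedQuarks.InterleavedHeatSliceFlow`, item stmt-QuantumFields-8891)

**Defect moment bound** (card pauli-pays-for-defect-modes; the consumer of `stub_defectMinorBound`
inside the engine).  For a complex `n × n` matrix `D`, `k ≤ n`, and injections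
`i j : Fin k ↪ Fin n`, the *unnormalised* Gaussian Berezin moment

  `M = ∫ dψ̄ dψ e^{-ψ̄Dψ} ψ̄_{i₀} ⋯ ψ̄_{i_{k-1}} ψ_{j₀} ⋯ ψ_{j_{k-1}}`

satisfies `‖M‖² ≤ ∏_{l < n-k} λₗ↓(Dᴴ D)`, the product of the squares of the `n - k` LARGEST singular
values of `D` (`eigenvalues₀` sorted decreasingly).  No invertibility of `D` is needed: small
singular values are absent from the bound, never inverted.

Proof.
* `prod_psiBar_mul_prod_psi` (tree) un-interleaves the block word into
  `(-1)^{k(k-1)/2} ∏ₐ ψ̄_{iₐ} ψ_{jₐ}`, and, `i` being injective, the product of pairs is the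
  `noncommProd` over `I = image i` of `ψ̄ᵣ ψ_{j' r}` for any `j'` with `j' ∘ i = j`; the tree's
  row-replacement Wick rule `berezin_grassmannExp_quadratic_mul_noncommProd` (valid for EVERY matrix)
  gives `M = ± det A'`, `A' = -D` with the rows `iₐ` replaced by the unit rows `e_{jₐ}`
  (`defectMomentBound_berezin_eq`).
* Reindex rows by `i ⊔ ci` and columns by `j ⊔ cj` (`ci`, `cj : Fin (n-k) ↪ Fin n` increasing
  enumerations of the complements of the ranges, `Finset.orderEmbOfFin`): the reindexed `A'` is
  `fromBlocks 1 0 _ ((-D)[ci, cj])` (`defectMomentBound_submatrix_rowReplace`), so its determinant is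
  the complementary minor `det (-D)[ci, cj]` (`Matrix.det_fromBlocks_zero₁₂`), while a two-sided
  reindexing only changes the determinant by the sign of a permutation
  (`defectMomentBound_norm_det_submatrix`).  Hence `‖M‖ = ‖det D[ci, cj]‖`
  (`defectMomentBound_exists_compl`).
* Conclude with the landed `stub_defectMinorBound` at `n - k` (p87601).
-/

namespace Summit.QuantumFields.QCD.Cruxes.InterleavedHeatSliceFlow.Sketch

open Literature.MathematicalPhysics.QuantumLattice
open scoped Matrix

section RowReplace

variable {n k m : ℕ}

/-- **The moment is `±` a row-replaced determinant.**  For any matrix `A`, injections `i j` and any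
`j'` with `j' (i a) = j a`:
`∫ dψ̄ dψ e^{ψ̄Aψ} ψ̄_{i₀} ⋯ ψ̄_{i_{k-1}} ψ_{j₀} ⋯ ψ_{j_{k-1}} = (-1)^{k(k-1)/2} (-1)^{n(n-1)/2} det A'`,
`A'` = `A` with row `r ∈ image i` replaced by the unit row `e_{j' r}` (tree:
`prod_psiBar_mul_prod_psi`, `berezin_grassmannExp_quadratic_mul_noncommProd`; no invertibility). -/
private theorem defectMomentBound_berezin_eq (A : Matrix (Fin n) (Fin n) ℂ) (i j : Fin k ↪ Fin n)
    (j' : Fin n → Fin n) (hj' : ∀ a, j' (i a) = j a) :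
    GrassmannAlgebra.berezin ℂ (Fin n ⊕ₗ Fin n)
        (grassmannExp (quadratic ℂ A) *
          ((List.ofFn fun a => psiBar ℂ (i a)).prod * (List.ofFn fun a => psi ℂ (j a)).prod)) =
      (-1 : ℂ) ^ (k * (k - 1) / 2) *
        ((-1 : ℂ) ^ (Fintype.card (Fin n) * (Fintype.card (Fin n) - 1) / 2) *
          (Matrix.of fun r c => if r ∈ Finset.univ.image i then
            (Pi.single (j' r) (1 : ℂ) : Fin n → ℂ) c else A r c).det) := by
  have hl : (List.ofFn i).toFinset = Finset.univ.image i := by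
    ext r
    simp only [List.mem_toFinset, List.mem_ofFn', Set.mem_range, Finset.mem_image,
      Finset.mem_univ, true_and]
  have hprod : (Finset.univ.image i).noncommProd (fun r => psiBar ℂ r * psi ℂ (j' r))
        (fun r _ _ _ _ => commute_psiBar_mul_psi ℂ r (j' r) _) =
      (List.ofFn fun a => psiBar ℂ (i a) * psi ℂ (j a)).prod := by
    rw [← Finset.noncommProd_congr hl (fun _ _ => rfl)
        fun r _ _ _ _ => commute_psiBar_mul_psi ℂ r (j' r) _,
      Finset.noncommProd_toFinset _ _ _ (List.nodup_ofFn.2 i.injective), List.map_ofFn]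
    congr 1
    exact congrArg List.ofFn (funext fun a => by simp only [Function.comp_apply, hj'])
  rw [prod_psiBar_mul_prod_psi ℂ i j, mul_smul_comm, map_smul, ← hprod,
    berezin_grassmannExp_quadratic_mul_noncommProd ℂ A _ j', smul_eq_mul]

/-- **Block structure of the row-replaced matrix.**  Reindex the rows by `i ⊔ ci` and the columns by
`j ⊔ cj`, where `ci` avoids the range of `i` and `cj` avoids the range of `j`: the rows `iₐ` are the
unit rows `e_{jₐ}`, so the reindexed matrix is `fromBlocks 1 0 _ A[ci, cj]`. -/
private theorem defectMomentBound_submatrix_rowReplace (A : Matrix (Fin n) (Fin n) ℂ)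
    (i j : Fin k ↪ Fin n) (j' : Fin n → Fin n) (hj' : ∀ a, j' (i a) = j a)
    (ci cj : Fin m ↪ Fin n) (hci : ∀ l, ci l ∉ Finset.univ.image i) (hcj : ∀ l a, cj l ≠ j a)
    (eR eC : Fin k ⊕ Fin m ≃ Fin n)
    (heR : ∀ x, eR x = Sum.elim i ci x) (heC : ∀ x, eC x = Sum.elim j cj x) :
    (Matrix.of fun r c => if r ∈ Finset.univ.image i then
        (Pi.single (j' r) (1 : ℂ) : Fin n → ℂ) c else A r c).submatrix eR eC =
      Matrix.fromBlocks 1 0 (Matrix.of fun l b => A (ci l) (j b)) (A.submatrix ci cj) := by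
  have hi : ∀ a, i a ∈ Finset.univ.image i := fun a =>
    Finset.mem_image_of_mem _ (Finset.mem_univ a)
  ext (a | l) (b | l')
  · rcases eq_or_ne a b with rfl | hab
    · simp only [Matrix.submatrix_apply, heR, heC, Sum.elim_inl, Matrix.of_apply, if_pos (hi a),
        hj', Pi.single_eq_same, Matrix.fromBlocks_apply₁₁, Matrix.one_apply_eq]
    · simp only [Matrix.submatrix_apply, heR, heC, Sum.elim_inl, Matrix.of_apply, if_pos (hi a),
        hj', Pi.single_eq_of_ne (j.injective.ne hab.symm), Matrix.fromBlocks_apply₁₁,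
        Matrix.one_apply_ne hab]
  · simp only [Matrix.submatrix_apply, heR, heC, Sum.elim_inl, Sum.elim_inr, Matrix.of_apply,
      if_pos (hi a), hj', Pi.single_eq_of_ne (hcj l' a), Matrix.fromBlocks_apply₁₂,
      Matrix.zero_apply]
  · simp only [Matrix.submatrix_apply, heR, heC, Sum.elim_inl, Sum.elim_inr, Matrix.of_apply,
      if_neg (hci l), Matrix.fromBlocks_apply₂₁]
  · simp only [Matrix.submatrix_apply, heR, heC, Sum.elim_inr, Matrix.of_apply, if_neg (hci l),
      Matrix.fromBlocks_apply₂₂]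

/-- Reindexing rows and columns by two (possibly different) equivalences changes the determinant
only by the sign of a permutation, hence preserves its norm. -/
private theorem defectMomentBound_norm_det_submatrix {o p : Type*} [Fintype o] [DecidableEq o]
    [Fintype p] [DecidableEq p] (M : Matrix p p ℂ) (e₁ e₂ : o ≃ p) :
    ‖(M.submatrix e₁ e₂).det‖ = ‖M.det‖ := by
  rw [show M.submatrix e₁ e₂ = (M.submatrix id (e₁.symm.trans e₂)).submatrix e₁ e₁ by
      ext x y; simp, Matrix.det_submatrix_equiv_self, Matrix.det_permute', norm_mul]
  rcases Int.units_eq_one_or (Equiv.Perm.sign (e₁.symm.trans e₂)) with h | h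
  · rw [h]; simp
  · rw [h]; simp

/-- **The row-replaced determinant is `±` the complementary minor.**  For `k ≤ n` there are
enumerations `ci`, `cj : Fin (n - k) ↪ Fin n` of the complements of the ranges of `i`, `j` with
`‖det A'‖ = ‖det A[ci, cj]‖`. -/
private theorem defectMomentBound_exists_compl (hk : k ≤ n) (A : Matrix (Fin n) (Fin n) ℂ)
    (i j : Fin k ↪ Fin n) (j' : Fin n → Fin n) (hj' : ∀ a, j' (i a) = j a) :
    ∃ ci cj : Fin (n - k) ↪ Fin n,
      ‖(Matrix.of fun r c => if r ∈ Finset.univ.image i then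
          (Pi.single (j' r) (1 : ℂ) : Fin n → ℂ) c else A r c).det‖ =
        ‖(A.submatrix ci cj).det‖ := by
  -- increasing enumerations of the complements of the ranges
  have hc : ∀ f : Fin k ↪ Fin n, (Finset.univ.image f)ᶜ.card = n - k := fun f => by
    rw [Finset.card_compl, Finset.card_image_of_injective _ f.injective, Finset.card_univ,
      Fintype.card_fin, Fintype.card_fin]
  have hm : ∀ (f : Fin k ↪ Fin n) (l : Fin (n - k)),
      (Finset.univ.image f)ᶜ.orderEmbOfFin (hc f) l ∉ Finset.univ.image f := fun f l =>
    Finset.mem_compl.1 (Finset.orderEmbOfFin_mem _ _ l)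
  have hm' : ∀ (f : Fin k ↪ Fin n) (l : Fin (n - k)) (a : Fin k),
      (Finset.univ.image f)ᶜ.orderEmbOfFin (hc f) l ≠ f a := fun f l a h =>
    hm f l (h ▸ Finset.mem_image_of_mem _ (Finset.mem_univ a))
  -- `f ⊔ (complement enumeration)` is a bijection `Fin k ⊕ Fin (n - k) → Fin n`
  have hb : ∀ f : Fin k ↪ Fin n,
      Function.Bijective (Sum.elim f ((Finset.univ.image f)ᶜ.orderEmbOfFin (hc f))) := fun f => by
    refine (Fintype.bijective_iff_injective_and_card _).2 ⟨?_, ?_⟩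
    · exact f.injective.sumElim ((Finset.univ.image f)ᶜ.orderEmbOfFin (hc f)).injective
        fun a l h => hm' f l a h.symm
    · simp only [Fintype.card_sum, Fintype.card_fin]
      omega
  refine ⟨((Finset.univ.image i)ᶜ.orderEmbOfFin (hc i)).toEmbedding,
    ((Finset.univ.image j)ᶜ.orderEmbOfFin (hc j)).toEmbedding, ?_⟩
  rw [← defectMomentBound_norm_det_submatrix _ (Equiv.ofBijective _ (hb i))
      (Equiv.ofBijective _ (hb j)),
    defectMomentBound_submatrix_rowReplace A i j j' hj' _ _ (hm i) (hm' j) _ _ (fun _ => rfl)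
      (fun _ => rfl),
    Matrix.det_fromBlocks_zero₁₂, Matrix.det_one, one_mul]

end RowReplace

/-- **Defect moment bound** (registered stub `stub_defectMomentBound` of line `Sketch`; card
pauli-pays-for-defect-modes): for every complex `n × n` matrix `D`, `k ≤ n` and injections
`i j : Fin k ↪ Fin n`, the unnormalised Gaussian Berezin moment
`M = ∫ dψ̄ dψ e^{-ψ̄Dψ} ψ̄_{i₀} ⋯ ψ̄_{i_{k-1}} ψ_{j₀} ⋯ ψ_{j_{k-1}}` satisfies
`‖M‖² ≤ ∏_{l < n-k} eigenvalues₀ (Dᴴ D) l`, the product of the `n - k` largest eigenvalues of `Dᴴ D`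
(squares of the largest singular values).  Proof: `‖M‖ = ‖det D[ci, cj]‖` for the complementary
`(n-k) × (n-k)` minor (`defectMomentBound_berezin_eq`, `defectMomentBound_exists_compl`), then the
landed `stub_defectMinorBound` at `n - k`. -/
theorem stub_defectMomentBound :
    ∀ (n k : ℕ) (hk : k ≤ n) (D : Matrix (Fin n) (Fin n) ℂ) (i j : Fin k ↪ Fin n),
      ‖GrassmannAlgebra.berezin ℂ (Fin n ⊕ₗ Fin n)
          (grassmannExp (quadratic ℂ (-D)) *
            ((List.ofFn fun a => psiBar ℂ (i a)).prod *
              (List.ofFn fun a => psi ℂ (j a)).prod))‖ ^ 2 ≤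
        ∏ l : Fin (n - k), (Matrix.isHermitian_conjTranspose_mul_self D).eigenvalues₀
          (Fin.cast (Fintype.card_fin n).symm (Fin.castLE (Nat.sub_le n k) l)) := by
  intro n k hk D i j
  obtain ⟨ci, cj, h⟩ := defectMomentBound_exists_compl hk (-D) i j (Function.extend i j id)
    fun a => i.injective.extend_apply _ _ a
  have hneg : ‖((-D).submatrix ci cj).det‖ = ‖(D.submatrix ci cj).det‖ := by
    rw [show (-D).submatrix ci cj = -D.submatrix ci cj from rfl, Matrix.det_neg, norm_mul,
      norm_pow, norm_neg, norm_one, one_pow, one_mul]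
  rw [defectMomentBound_berezin_eq (-D) i j _ fun a => i.injective.extend_apply _ _ a, norm_mul,
    norm_mul, norm_pow, norm_pow, norm_neg, norm_one, one_pow, one_pow, one_mul, one_mul, h, hneg]
  exact stub_defectMinorBound n (n - k) (Nat.sub_le n k) D ci cj

end Summit.QuantumFields.QCD.Cruxes.InterleavedHeatSliceFlow.Sketch
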